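import Literature.Geometry.Lorentzian.Stationary
import Mathlib.AlgebraicTopology.FundamentalGroupoid.SimplyConnected
import Mathlib.Topology.Homotopy.Equiv
import HarnessLib

/-!
# Crux `HawkingExtensionIsKerr` (stmt-FinalStateConjecture-17840), line `SketchIdeator2` —
# programme TOP, brick SL-B: the slice of Wald's function is a retract

Helper file of the line lead (c8) towards the registered stub `stub_top_slice`; pure topology of a
continuous flow.  Given a continuous flow `θ : ℝ × M → M` (`θ (0, ·) = id`), a closed `θ`-invariant
set `D`, a closed `θ`-invariant subset `H ⊆ D` (later `𝓔⁺ ⊆ doc ∪ 𝓔⁺`), a function `F` continuous on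
`D` and a CONTINUOUS crossing time `u` on `D` such that along every orbit through `y ∈ D` the level
`3` of `F` is taken exactly at the parameter `u y` (`F (θ (s, y)) = 3 ↔ s = u y`, brick SL-A), the
slice `S := {y ∈ D | F y = 3}` is closed, `r y := θ (u y, y)` is a continuous retraction `D → S`
(`top_sliceRetract`), so `S` is simply connected when `D` is (`simplyConnectedSpace_of_retraction`),
and `Σ := S ∩ H` is a strong deformation retract of `H` along the orbits
(`s ↦ θ (s · u y, y)`), in particular homotopy equivalent to `H` (`top_sliceSection_homotopyEquiv`).
-/

noncomputable section

set_option linter.dupNamespace false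

namespace Summit.FinalStateConjecture.FinalStateConjecture.Theorems.HawkingExtensionIsKerr.SketchIdeator2

open Set Filter Function Literature.Geometry.Lorentzian
open scoped Manifold Topology ContinuousMap

/-- **A retract of a simply connected space is simply connected**: if `r : X → A` is a continuous
retraction onto `A ⊆ X` (`r a = a` on `A`) and `X` is simply connected, so is `A` (paths in `A` are
homotopic in `X`, and `r` carries the homotopy back into `A`). -/
theorem simplyConnectedSpace_of_retraction {X : Type*} [TopologicalSpace X] {A : Set X}
    (r : C(X, ↥A)) (hr : ∀ a : ↥A, r a = a) [SimplyConnectedSpace X] : SimplyConnectedSpace ↥A := by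
  rw [simply_connected_iff_paths_homotopic']
  have hsurj : Surjective r := fun a ↦ ⟨a, hr a⟩
  refine ⟨hsurj.pathConnectedSpace r.continuous, fun {x y} p₁ p₂ ↦ ?_⟩
  set i : C(↥A, X) := ⟨Subtype.val, continuous_subtype_val⟩ with hi
  have h : Path.Homotopic (p₁.map i.continuous) (p₂.map i.continuous) :=
    SimplyConnectedSpace.paths_homotopic _ _
  have h' := h.map r
  have e : ∀ p : Path x y, (p.map i.continuous).map r.continuous = p.cast (hr x) (hr y) := by
    intro p; ext t; exact congrArg Subtype.val (hr (p t))
  rw [e p₁, e p₂] at h'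
  have h'' := h'.pathCast (hr x).symm (hr y).symm
  have e2 : ∀ p : Path x y, (p.cast (hr x) (hr y)).cast (hr x).symm (hr y).symm = p :=
    fun p ↦ by ext; rfl
  rwa [e2, e2] at h''

/-- **SL-B, the slice is a retract.**  With the notation of the module docstring:
`S = {y ∈ D | F y = 3}` is closed; `y ↦ θ (u y, y)` maps `D` into `S`, continuously, and fixes `S`
pointwise (`u = 0` on `S`); hence `S` is simply connected if `D` is. -/
theorem top_sliceRetract (𝓑 : StationaryAFBlackHole.{0}) (D : Set 𝓑.carrier) (hD : IsClosed D)
    (θ : ℝ × 𝓑.carrier → 𝓑.carrier) (hθc : Continuous θ) (hθ0 : ∀ p, θ (0, p) = p)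
    (hθD : ∀ s, ∀ x ∈ D, θ (s, x) ∈ D)
    (F u : 𝓑.carrier → ℝ) (hFc : ContinuousOn F D) (huc : ContinuousOn u D)
    (hFu : ∀ y ∈ D, ∀ s, F (θ (s, y)) = 3 ↔ s = u y) :
    IsClosed {y | y ∈ D ∧ F y = 3} ∧
    (∀ y ∈ D, θ (u y, y) ∈ {y | y ∈ D ∧ F y = 3}) ∧
    (∀ y ∈ {y | y ∈ D ∧ F y = 3}, u y = 0) ∧
    (∀ y ∈ {y | y ∈ D ∧ F y = 3}, θ (u y, y) = y) ∧
    ContinuousOn (fun y ↦ θ (u y, y)) D ∧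
    (SimplyConnectedSpace ↥D → SimplyConnectedSpace ↥{y | y ∈ D ∧ F y = 3}) := by
  have hS : IsClosed {y | y ∈ D ∧ F y = 3} := by
    have : {y | y ∈ D ∧ F y = 3} = D ∩ F ⁻¹' {3} := by ext y; simp
    rw [this]
    exact hFc.preimage_isClosed_of_isClosed hD isClosed_singleton
  have hrS : ∀ y ∈ D, θ (u y, y) ∈ {y | y ∈ D ∧ F y = 3} :=
    fun y hy ↦ ⟨hθD _ y hy, (hFu y hy (u y)).2 rfl⟩
  have hu0 : ∀ y ∈ {y | y ∈ D ∧ F y = 3}, u y = 0 := by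
    rintro y ⟨hy, hFy⟩
    have : F (θ (0, y)) = 3 := by rw [hθ0]; exact hFy
    exact ((hFu y hy 0).1 this).symm
  have hfix : ∀ y ∈ {y | y ∈ D ∧ F y = 3}, θ (u y, y) = y := by
    intro y hy; rw [hu0 y hy, hθ0]
  have hrc : ContinuousOn (fun y ↦ θ (u y, y)) D :=
    hθc.comp_continuousOn (huc.prodMk continuousOn_id)
  refine ⟨hS, hrS, hu0, hfix, hrc, fun hsc ↦ ?_⟩
  -- the retraction as a continuous map `↥D → ↥S`, and `S` as a retract of `↥D`
  set S : Set 𝓑.carrier := {y | y ∈ D ∧ F y = 3} with hSdef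
  have hSD : S ⊆ D := fun y hy ↦ hy.1
  set S' : Set ↥D := Subtype.val ⁻¹' S with hS'def
  have hr'c : Continuous fun x : ↥D ↦ (⟨⟨θ (u x.1, x.1), (hrS x.1 x.2).1⟩, hrS x.1 x.2⟩ : ↥S') := by
    refine Continuous.subtype_mk (Continuous.subtype_mk ?_ _) _
    exact hrc.comp_continuous continuous_subtype_val fun x ↦ x.2
  set r' : C(↥D, ↥S') := ⟨fun x ↦ ⟨⟨θ (u x.1, x.1), (hrS x.1 x.2).1⟩, hrS x.1 x.2⟩, hr'c⟩ with hr'def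
  have hr' : ∀ a : ↥S', r' a = a := by
    rintro ⟨⟨a, haD⟩, haS⟩
    exact Subtype.ext (Subtype.ext (hfix a haS))
  haveI : SimplyConnectedSpace ↥S' := simplyConnectedSpace_of_retraction r' hr'
  -- `↥S' ≃ₜ ↥S`
  have e : ↥S' ≃ₜ ↥S :=
    { toFun := fun x ↦ ⟨x.1.1, x.2⟩
      invFun := fun y ↦ ⟨⟨y.1, hSD y.2⟩, y.2⟩
      left_inv := fun x ↦ rfl
      right_inv := fun y ↦ rfl
      continuous_toFun := by fun_prop
      continuous_invFun := by fun_prop }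
  exact e.symm.toHomotopyEquiv.simplyConnectedSpace

/-- **SL-B, the horizon section of the slice is homotopy equivalent to the horizon.**  If moreover
`H ⊆ D` is closed and `θ`-invariant, then `Σ := S ∩ H` is closed and the inclusion `Σ ↪ H` is a
homotopy equivalence with homotopy inverse the retraction `y ↦ θ (u y, y)` (the homotopy
`(s, y) ↦ θ (s · u y, y)` runs inside `H`). -/
theorem top_sliceSection_homotopyEquiv (𝓑 : StationaryAFBlackHole.{0}) (D H : Set 𝓑.carrier)
    (hH : IsClosed H) (hHD : H ⊆ D)
    (θ : ℝ × 𝓑.carrier → 𝓑.carrier) (hθc : Continuous θ) (hθ0 : ∀ p, θ (0, p) = p)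
    (hθH : ∀ s, ∀ x ∈ H, θ (s, x) ∈ H)
    (F u : 𝓑.carrier → ℝ) (huc : ContinuousOn u D)
    (hS : IsClosed {y | y ∈ D ∧ F y = 3})
    (hrS : ∀ y ∈ D, θ (u y, y) ∈ {y | y ∈ D ∧ F y = 3})
    (hfix : ∀ y ∈ {y | y ∈ D ∧ F y = 3}, θ (u y, y) = y) :
    IsClosed ({y | y ∈ D ∧ F y = 3} ∩ H) ∧
    Nonempty (ContinuousMap.HomotopyEquiv ↥({y | y ∈ D ∧ F y = 3} ∩ H) ↥H) := by
  set S : Set 𝓑.carrier := {y | y ∈ D ∧ F y = 3} with hSdef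
  refine ⟨hS.inter hH, ⟨?_⟩⟩
  have huH : ContinuousOn u H := huc.mono hHD
  have hrB : ∀ y ∈ H, θ (u y, y) ∈ S ∩ H := fun y hy ↦ ⟨hrS y (hHD hy), hθH _ y hy⟩
  -- the maps
  set incl : C(↥(S ∩ H), ↥H) := ⟨fun x ↦ ⟨x.1, x.2.2⟩, by fun_prop⟩ with hincl
  have hrc : Continuous fun y : ↥H ↦ (⟨θ (u y.1, y.1), hrB y.1 y.2⟩ : ↥(S ∩ H)) := by
    refine Continuous.subtype_mk ?_ _
    exact hθc.comp ((huH.comp_continuous continuous_subtype_val fun y ↦ y.2).prodMk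
      continuous_subtype_val)
  set r : C(↥H, ↥(S ∩ H)) := ⟨fun y ↦ ⟨θ (u y.1, y.1), hrB y.1 y.2⟩, hrc⟩ with hrdef
  -- the homotopy from `id` to `incl ∘ r` inside `H`
  have hGc : Continuous fun p : unitInterval × ↥H ↦
      (⟨θ ((p.1 : ℝ) * u p.2.1, p.2.1), hθH _ _ p.2.2⟩ : ↥H) := by
    refine Continuous.subtype_mk ?_ _
    refine hθc.comp (Continuous.prodMk ?_ (continuous_subtype_val.comp continuous_snd))
    exact (continuous_induced_dom.comp continuous_fst).mul
      (huH.comp_continuous (continuous_subtype_val.comp continuous_snd) fun p ↦ p.2.2)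
  let G : (ContinuousMap.id ↥H).Homotopy (incl.comp r) :=
    { toFun := fun p ↦ ⟨θ ((p.1 : ℝ) * u p.2.1, p.2.1), hθH _ _ p.2.2⟩
      continuous_toFun := hGc
      map_zero_left := fun y ↦ by
        apply Subtype.ext
        show θ (((0 : unitInterval) : ℝ) * u y.1, y.1) = y.1
        simp [hθ0]
      map_one_left := fun y ↦ by
        apply Subtype.ext
        show θ (((1 : unitInterval) : ℝ) * u y.1, y.1) = θ (u y.1, y.1)
        simp }
  refine
    { toFun := incl
      invFun := r
      left_inv := ?_
      right_inv := ⟨G.symm⟩ }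
  -- `r ∘ incl = id` on the nose
  have : r.comp incl = ContinuousMap.id _ := by
    ext x
    · show θ (u x.1, x.1) = x.1
      exact hfix x.1 x.2.1
  rw [this]

end Summit.FinalStateConjecture.FinalStateConjecture.Theorems.HawkingExtensionIsKerr.SketchIdeator2

end
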